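import Literature.Geometry.Lorentzian.InverseMeanCurvatureFlowUniqueness
import Literature.Algebra.EuclideanLattices.LatticePointCounting
import HarnessLib

/-!
# Inverse mean curvature flow I — proofs: the negative extension into `E₀` and the reduction of
# the Weak Existence Theorem 3.1 to existence on the exterior `M ∖ E₀`

Sorry-free continuation of `InverseMeanCurvatureFlowProofs.lean` and
`InverseMeanCurvatureFlowUniqueness.lean` (Huisken–Ilmanen, J. Differential Geom. 59 (2001), §3,
proof of Thm. 3.1). The printed proof constructs the solution `u` of the initial value problem
(††) *on the exterior* `M ∖ E₀` only — as a locally uniform limit, with local Lipschitz bounds on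
compact subsets of `M ∖ E₀`, of the solutions `u^ε ≥ 0` of the regularised problems `(⋆)_ε`, all
vanishing on `∂E₀` — checks (1.5) on `M ∖ Ē₀`, and then disposes of the initial condition in one
sentence: "Finally, extend `u` negatively to `E₀` so that `E₀ = {u < 0}`. This completes the proof
of existence of the initial value problem (††)" (p. 36 of the printed paper, end of step 1), the
uniqueness clause being Thm. 2.2 (iii) (last paragraph of the proof). This file proves these two
book-keeping steps for the level-set formulation of `InverseMeanCurvatureFlow.lean`, so that the
named fact `weak_existence` is reduced to exactly the analytic output of steps 1–2 of the printed
proof (elliptic regularisation and the limits `ε → 0`, `L → ∞`), stated on the closed exterior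
`E₀ᶜ`:

* `IsLocLipschitzOn.congr`, `imcfEnergy_congr_left`, `IsCompetitor.congr_left`,
  `IsWeakSolution.congr` — the weak formulation (1.5) on an open set `Ω` only depends on the
  values of `u` on `Ω` (locality of the slope `|∇u|`, `gradNorm_congr_of_eqOn`);
* (from `LatticePointCounting.lean`: `isPreconnected_inter_frontier_nonempty` — a preconnected
  set meeting `E₀` and `E₀ᶜ` meets `∂E₀`, applied to the chart segment between a point of `E₀` and
  a point of `E₀ᶜ`);
* `exists_isLocLipschitzOn_extend_neg` — **the negative extension**: if `E₀` is open, `u₀` is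
  locally Lipschitz on `E₀ᶜ` (for the Riemannian distance, up to the boundary) and `u₀ = 0` on
  `∂E₀`, then `u := u₀` on `E₀ᶜ`, `u := -min(1, dist_h(·, E₀ᶜ))` on `E₀` is locally Lipschitz on
  all of `X`, agrees with `u₀` off `E₀` and is negative exactly… on `E₀`. The only non-trivial
  point is the Lipschitz bound across `∂E₀` near a boundary point `p`: in a chart at `p` that is
  `2`-bi-Lipschitz for the length distance (`exists_nhds_riemannianEDist_le_and_edist_le`,
  `VolumeChartFormula.lean`) the chart segment from `y ∈ E₀ᶜ` to `x ∈ E₀` crosses `∂E₀` at a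
  point `q` with `d(y, q) ≤ 4 d(x, y)`, whence `|u₀(y)| = |u₀(y) - u₀(q)| ≤ 4K d(x, y)`, while
  `dist_h(x, E₀ᶜ) ≤ d(x, y)`;
* `exists_isWeakSolutionIVP_of_exterior` — **from an exterior solution to a proper solution of
  (††)**: if moreover `u₀ ≥ 0` on `E₀ᶜ`, the sets `{x ∈ E₀ᶜ | u₀ x ≤ t}` are compact ("`u → ∞`",
  properness at infinity), `Ē₀` is compact and `u₀` satisfies (1.5) on `M ∖ Ē₀`, then the
  extension `u` is proper (`IsProperFun`) and solves (††) with initial condition `E₀`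
  (`IsWeakSolutionIVP`), and `u = u₀` off `E₀`;
* `weak_existence_of_exterior_existence` — **reduction of the named fact `weak_existence`**
  (Thm. 3.1 for `n = 3`) to the existence, for every datum of the fact, of such an exterior
  solution `u₀`; the uniqueness clause is `weak_uniqueness`
  (`InverseMeanCurvatureFlowUniqueness.lean`, Thm. 2.2 (iii)).

Everything is proved; there are no definitions and no named facts. What remains of Thm. 3.1 is
its analytic core on the exterior: the Compactness Theorem 2.1, the approximate minimality of the
regularised solutions (Lemma 2.3), the a priori estimates and the solvability of `(⋆)_ε`
(Lemmas 3.4–3.5, Hölder-space elliptic theory) and the conic modification of step 2.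

## References

* G. Huisken, T. Ilmanen, *The inverse mean curvature flow and the Riemannian Penrose
  inequality*, J. Differential Geom. 59 (2001) 353–437: §1 (††) and the remark following it;
  §3, Thm. 3.1 and its proof, step 1 (last paragraph: "extend `u` negatively to `E₀`") and the
  last paragraph of step 2 ("Theorem 2.2(iii) implies that `u` is unique").
* D. Burago, Yu. Burago, S. Ivanov, *A course in metric geometry*, AMS 2001, §5.1 (charts are
  locally bi-Lipschitz for the length metric).
-/

noncomputable section

open Bundle Set Manifold TopologicalSpace Filter MeasureTheory Function Metric
open scoped ContDiff Topology ENNReal NNReal Manifold Real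

namespace Literature.Geometry.Lorentzian

open PseudoRiemannianMetric

variable {X : Type*} [TopologicalSpace X] [ChartedSpace E3 X] [IsManifold (𝓡 3) ∞ X]

/-! ### The weak formulation only sees `u` on `Ω` -/

section Congr

variable (h : ContMDiffRiemannianMetric (𝓡 3) ∞ E3 (TangentSpace (𝓡 3) : X → Type _))
  [T2Space X] [LocallyCompactSpace X]

/-- Local Lipschitz continuity on `Ω` (for the Riemannian distance) only depends on the values on
`Ω`. [folklore] -/
theorem IsLocLipschitzOn.congr {u v : X → ℝ} {Ω : Set X} (hu : IsLocLipschitzOn h u Ω)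
    (huv : EqOn u v Ω) : IsLocLipschitzOn h v Ω := by
  letI : RiemannianBundle (fun x : X ↦ TangentSpace (𝓡 3) x) :=
    ⟨h.toContinuousRiemannianMetric.toRiemannianMetric⟩
  letI : PseudoEMetricSpace X := .ofRiemannianMetric (𝓡 3) X
  change LocallyLipschitzOn Ω v
  intro x hx
  obtain ⟨K, t, ht, hK⟩ := (show LocallyLipschitzOn Ω u from hu) hx
  refine ⟨K, t ∩ Ω, inter_mem ht self_mem_nhdsWithin, fun a ha b hb ↦ ?_⟩
  rw [← huv ha.2, ← huv hb.2]
  exact hK ha.1 hb.1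

variable [MeasurableSpace X] [BorelSpace X]

/-- The energy `J_u^K(v)` only depends on `u` through its values on an open set `Ω ⊇ K`
(locality of the frozen slope `|∇u|`). [folklore] -/
theorem imcfEnergy_congr_left {u u' : X → ℝ} {K Ω : Set X} (hΩ : IsOpen Ω) (heq : EqOn u u' Ω)
    (hK : IsCompact K) (hKΩ : K ⊆ Ω) (v : X → ℝ) :
    imcfEnergy h u K v = imcfEnergy h u' K v := by
  unfold imcfEnergy
  refine setIntegral_congr_fun hK.measurableSet fun x hx ↦ ?_
  simp only [gradNorm_congr_of_eqOn h hΩ heq (hKΩ hx)]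

omit [MeasurableSpace X] [BorelSpace X] in
/-- Competitors for `u` on `Ω` are competitors for any `u'` agreeing with `u` on `Ω`. [folklore] -/
theorem IsCompetitor.congr_left {u u' v : X → ℝ} {Ω : Set X} (hv : IsCompetitor h u Ω v)
    (heq : EqOn u u' Ω) : IsCompetitor h u' Ω v := by
  obtain ⟨hvl, C, hC, hCΩ, hvC⟩ := hv
  refine ⟨hvl, C, hC, hCΩ, fun x hx ↦ hvC ⟨hx.1, ?_⟩⟩
  rw [heq hx.1]
  exact hx.2

/-- **The weak formulation (1.5) on an open set `Ω` only depends on `u|_Ω`**: if `u` is a weak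
solution of (∗∗) on `Ω` and `u' = u` on `Ω`, then so is `u'`. (Competitors and the constraint
`{v ≠ u} ⊂⊂ Ω` are read on `Ω`; the energies over compact `K ⊆ Ω` agree by locality of the slope.)
This is what allows the solution constructed on `M ∖ E₀` to be modified inside `E₀` in the proof
of Thm. 3.1. [cite: HuiskenIlmanenIMCF2001, §1 Definition (1.5) and proof of Thm. 3.1 step 1] -/
theorem IsWeakSolution.congr {u u' : X → ℝ} {Ω : Set X} (hu : IsWeakSolution h u Ω)
    (hΩ : IsOpen Ω) (heq : EqOn u u' Ω) : IsWeakSolution h u' Ω := by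
  refine ⟨hu.1.congr h heq, fun v hv K hK hKΩ hvK ↦ ?_⟩
  have hv' : IsCompetitor h u Ω v := hv.congr_left h heq.symm
  have hvK' : {x | x ∈ Ω ∧ v x ≠ u x} ⊆ K := by
    intro x hx
    refine hvK ⟨hx.1, ?_⟩
    rw [← heq hx.1]
    exact hx.2
  have key := hu.2 v hv' K hK hKΩ hvK'
  have h1 : imcfEnergy h u' K u' = imcfEnergy h u K u := by
    rw [← imcfEnergy_congr_left h hΩ heq hK hKΩ u',
      imcfEnergy_congr_of_eqOn h hΩ hK hKΩ heq.symm]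
  rw [h1, ← imcfEnergy_congr_left h hΩ heq hK hKΩ v]
  exact key

end Congr

/-! ### The negative extension into `E₀` -/

section Extension

variable (h : ContMDiffRiemannianMetric (𝓡 3) ∞ E3 (TangentSpace (𝓡 3) : X → Type _))
  [T2Space X] [LocallyCompactSpace X]

set_option backward.isDefEq.respectTransparency false in
/-- **Negative extension across the initial surface.** Let `E₀ ⊆ X` be open, `u₀` locally
Lipschitz on `E₀ᶜ` for the Riemannian distance (up to the boundary: Lipschitz on a relative
neighbourhood in `E₀ᶜ` of each of its points) with `u₀ = 0` on `∂E₀`. Then there is a function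
`u`, locally Lipschitz on all of `X`, with `u = u₀` on `E₀ᶜ` and `u < 0` on `E₀` — namely
`u = -min(1, dist_h(·, E₀ᶜ))` on `E₀`. Near a boundary point, a chart `2`-bi-Lipschitz for the
length distance is used: the chart segment from `y ∈ E₀ᶜ` to `x ∈ E₀` meets `∂E₀` at some `q` with
`d(y, q) ≤ 4 d(x, y)`, so `|u₀ y| ≤ 4K d(x, y)` and `|u x - u y| ≤ (1 + 4K) d(x, y)`. This is the
sentence "Finally, extend `u` negatively to `E₀` so that `E₀ = {u < 0}`" of the proof of Thm. 3.1.
[cite: HuiskenIlmanenIMCF2001, proof of Thm. 3.1 step 1 (last paragraph)] -/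
theorem exists_isLocLipschitzOn_extend_neg {E₀ : Set X} (hE₀ : IsOpen E₀) {u₀ : X → ℝ}
    (hu₀ : IsLocLipschitzOn h u₀ E₀ᶜ) (h0 : ∀ x ∈ frontier E₀, u₀ x = 0) :
    ∃ u : X → ℝ, IsLocLipschitzOn h u univ ∧ EqOn u u₀ E₀ᶜ ∧ ∀ x ∈ E₀, u x < 0 := by
  classical
  letI : RiemannianBundle (fun x : X ↦ TangentSpace (𝓡 3) x) :=
    ⟨h.toContinuousRiemannianMetric.toRiemannianMetric⟩
  letI : PseudoEMetricSpace X := .ofRiemannianMetric (𝓡 3) X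
  -- the truncated distance to `E₀ᶜ`
  set m : X → ℝ≥0∞ := fun x ↦ min 1 (infEDist x E₀ᶜ) with hm
  have hm_top : ∀ x, m x ≠ ⊤ := fun x ↦ ne_top_of_le_ne_top ENNReal.one_ne_top (min_le_left _ _)
  have hm_le : ∀ x y, m x ≤ m y + edist x y := by
    intro x y
    calc m x ≤ min 1 (infEDist y E₀ᶜ + edist x y) :=
          min_le_min le_rfl infEDist_le_infEDist_add_edist
      _ ≤ min (1 + edist x y) (infEDist y E₀ᶜ + edist x y) :=
          min_le_min le_self_add le_rfl
      _ = m y + edist x y := min_add_add_right _ _ _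
  set d : X → ℝ := fun x ↦ (m x).toReal with hd
  have hd_nonneg : ∀ x, 0 ≤ d x := fun x ↦ ENNReal.toReal_nonneg
  have hd_sub_le : ∀ x y, edist x y ≠ ⊤ → d x - d y ≤ (edist x y).toReal := by
    intro x y hxy
    have := ENNReal.toReal_mono (ENNReal.add_ne_top.2 ⟨hm_top y, hxy⟩) (hm_le x y)
    rw [ENNReal.toReal_add (hm_top y) hxy] at this
    simp only [hd]
    linarith
  have hd_edist : ∀ x y, edist (d x) (d y) ≤ edist x y := by
    intro x y
    by_cases hxy : edist x y = ⊤
    · rw [hxy]; exact le_top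
    rw [edist_dist, Real.dist_eq]
    calc ENNReal.ofReal |d x - d y| ≤ ENNReal.ofReal (edist x y).toReal := by
          apply ENNReal.ofReal_le_ofReal
          rw [abs_sub_le_iff]
          refine ⟨hd_sub_le x y hxy, ?_⟩
          rw [edist_comm] at hxy ⊢
          exact hd_sub_le y x hxy
      _ ≤ edist x y := ENNReal.ofReal_toReal_le
  have hd_pos : ∀ x ∈ E₀, 0 < d x := by
    intro x hx
    have h1 : 0 < infEDist x E₀ᶜ := by
      rw [infEDist_pos_iff_notMem_closure, hE₀.isClosed_compl.closure_eq]
      exact fun hx' ↦ hx' hx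
    have h2 : m x ≠ 0 := (lt_min zero_lt_one h1).ne'
    exact ENNReal.toReal_pos h2 (hm_top x)
  have hd_le_edist : ∀ x, ∀ y ∈ E₀ᶜ, ENNReal.ofReal (d x) ≤ edist x y := by
    intro x y hy
    rw [hd, ENNReal.ofReal_toReal (hm_top x)]
    exact (min_le_right _ _).trans (infEDist_le_edist_of_mem hy)
  -- the extension
  set u : X → ℝ := E₀ᶜ.piecewise u₀ (fun x ↦ -d x) with hu
  have hu_in : ∀ x ∈ E₀, u x = -d x := fun x hx ↦
    Set.piecewise_eq_of_notMem _ _ _ (fun hx' ↦ hx' hx)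
  have hu_out : EqOn u u₀ E₀ᶜ := Set.piecewise_eqOn _ _ _
  refine ⟨u, ?_, hu_out, fun x hx ↦ by rw [hu_in x hx]; exact neg_lt_zero.2 (hd_pos x hx)⟩
  -- Lipschitz bound for pairs inside `E₀`
  have hEE : ∀ a ∈ E₀, ∀ b ∈ E₀, edist (u a) (u b) ≤ edist a b := by
    intro a ha b hb
    rw [hu_in a ha, hu_in b hb, edist_neg_neg]
    exact hd_edist a b
  change LocallyLipschitzOn univ u
  refine LocallyLipschitz.locallyLipschitzOn fun x ↦ ?_
  by_cases hxE : x ∈ E₀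
  · -- interior of the initial condition: `u = -d` is `1`-Lipschitz
    exact ⟨1, E₀, hE₀.mem_nhds hxE, fun a ha b hb ↦ by
      rw [ENNReal.coe_one, one_mul]; exact hEE a ha b hb⟩
  -- a point of `E₀ᶜ`: Lipschitz data for `u₀` and a bi-Lipschitz chart neighbourhood
  obtain ⟨K, t, ht, hK⟩ := (show LocallyLipschitzOn E₀ᶜ u₀ from hu₀) hxE
  obtain ⟨O, hO, hxO, hOt⟩ := mem_nhdsWithin.1 ht
  set φ := extChartAt (𝓡 3) x with hφ
  obtain ⟨A, hA⟩ := exists_norm_eq_norm_symmL (I := 𝓡 3) x x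
  obtain ⟨U, hU, hUsrc, hle, hge⟩ :=
    exists_nhds_riemannianEDist_le_and_edist_le (I := 𝓡 3) x x (mem_chart_source E3 x) hA
      one_lt_two
  have hUsrc' : U ⊆ φ.source := by rw [hφ, extChartAt_source]; exact hUsrc
  -- a Euclidean ball in the chart inside the image of `U ∩ O`
  have hW : φ '' (U ∩ O) ∈ 𝓝 (φ x) :=
    extChartAt_image_nhds_mem_nhds_of_boundaryless (inter_mem hU (hO.mem_nhds hxO))
  obtain ⟨ε, hε, hball⟩ := Metric.mem_nhds_iff.1 hW
  have hback : ∀ z ∈ ball (φ x) ε, φ.symm z ∈ U ∩ O ∧ z ∈ φ.target ∧ φ (φ.symm z) = z := by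
    intro z hz
    obtain ⟨a, haUO, rfl⟩ := hball hz
    have ha : a ∈ φ.source := hUsrc' haUO.1
    refine ⟨by rwa [φ.left_inv ha], φ.map_source ha, by rw [φ.left_inv ha]⟩
  -- the neighbourhood `V` on which `u` is Lipschitz
  set V : Set X := φ.source ∩ φ ⁻¹' ball (φ x) ε with hV
  have hVnhds : V ∈ 𝓝 x :=
    inter_mem (extChartAt_source_mem_nhds x)
      ((continuousAt_extChartAt x).preimage_mem_nhds (Metric.ball_mem_nhds _ hε))
  have hVUO : ∀ a ∈ V, a ∈ U ∩ O := by
    intro a ha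
    have := (hback (φ a) ha.2).1
    rwa [φ.left_inv ha.1] at this
  have hVt : ∀ a ∈ V, a ∉ E₀ → a ∈ t := fun a ha haE ↦ hOt ⟨(hVUO a ha).2, haE⟩
  -- the key estimate across the boundary
  have hcross : ∀ a ∈ V, a ∈ E₀ → ∀ b ∈ V, b ∉ E₀ →
      edist (u a) (u b) ≤ (1 + 4 * K : ℝ≥0∞) * edist a b := by
    intro a ha haE b hb hbE
    -- the chart segment from `φ b` to `φ a` and its pull-back
    set γ : ℝ → E3 := fun s ↦ φ b + s • (φ a - φ b) with hγ
    have hγball : ∀ s ∈ Icc (0 : ℝ) 1, γ s ∈ ball (φ x) ε := fun s hs ↦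
      (convex_ball (φ x) ε).add_smul_sub_mem hb.2 ha.2 hs
    set P : ℝ → X := fun s ↦ φ.symm (γ s) with hP
    have hPcont : ContinuousOn P (Icc 0 1) := by
      refine (continuousOn_extChartAt_symm x).comp (Continuous.continuousOn (by fun_prop))
        fun s hs ↦ (hback (γ s) (hγball s hs)).2.1
    have hP1 : P 1 = a := by
      simp only [hP, hγ, one_smul, add_sub_cancel]
      exact φ.left_inv ha.1
    have hP0 : P 0 = b := by
      simp only [hP, hγ, zero_smul, add_zero]
      exact φ.left_inv hb.1
    obtain ⟨q, ⟨s₀, hs₀, rfl⟩, hqfr⟩ :=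
      Literature.Algebra.EuclideanLattices.isPreconnected_inter_frontier_nonempty
        (isPreconnected_Icc.image P hPcont) ⟨a, ⟨1, ⟨zero_le_one, le_rfl⟩, hP1⟩, haE⟩
        ⟨b, ⟨0, ⟨le_rfl, zero_le_one⟩, hP0⟩, hbE⟩
    have hqUO : P s₀ ∈ U ∩ O := (hback (γ s₀) (hγball s₀ hs₀)).1
    have hφq : φ (P s₀) = γ s₀ := (hback (γ s₀) (hγball s₀ hs₀)).2.2
    have hqE : P s₀ ∉ E₀ := fun hq ↦ by
      rw [hE₀.frontier_eq] at hqfr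
      exact hqfr.2 hq
    have hq0 : u₀ (P s₀) = 0 := h0 _ hqfr
    -- `|u₀ b| ≤ 4 K d(a, b)`
    have h1 : edist (u₀ b) 0 ≤ K * edist b (P s₀) := by
      rw [← hq0]
      exact hK (hVt b hb hbE) (hOt ⟨hqUO.2, hqE⟩)
    have h2 : edist b (P s₀) ≤ 2 * edist (A (φ b)) (A (φ (P s₀))) :=
      hle b (hVUO b hb).1 (P s₀) hqUO.1
    have h3 : edist (A (φ b)) (A (φ (P s₀))) ≤ edist (A (φ a)) (A (φ b)) := by
      rw [hφq, edist_eq_enorm_sub, edist_eq_enorm_sub, ← map_sub, ← map_sub]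
      have hsub : φ b - γ s₀ = (-s₀) • (φ a - φ b) := by
        simp only [hγ, neg_smul]; abel
      rw [hsub, map_smul, enorm_smul]
      calc ‖-s₀‖ₑ * ‖A (φ a - φ b)‖ₑ ≤ 1 * ‖A (φ a - φ b)‖ₑ := by
            gcongr
            rw [enorm_neg, Real.enorm_eq_ofReal hs₀.1]
            exact ENNReal.ofReal_le_one.2 hs₀.2
        _ = ‖A (φ a - φ b)‖ₑ := one_mul _
    have h4 : edist (A (φ a)) (A (φ b)) ≤ 2 * edist a b :=
      hge a (hVUO a ha).1 b (hVUO b hb).1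
    have h5 : edist (u₀ b) 0 ≤ (4 * K : ℝ≥0∞) * edist a b :=
      calc edist (u₀ b) 0 ≤ K * edist b (P s₀) := h1
        _ ≤ K * (2 * edist (A (φ b)) (A (φ (P s₀)))) := by gcongr
        _ ≤ K * (2 * edist (A (φ a)) (A (φ b))) := by gcongr
        _ ≤ K * (2 * (2 * edist a b)) := by gcongr
        _ = (4 * K : ℝ≥0∞) * edist a b := by ring
    have h6 : edist (u a) 0 ≤ edist a b := by
      rw [hu_in a haE, edist_zero_right, enorm_neg, Real.enorm_eq_ofReal (hd_nonneg a)]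
      exact hd_le_edist a b hbE
    calc edist (u a) (u b) ≤ edist (u a) 0 + edist 0 (u b) := edist_triangle _ _ _
      _ ≤ edist a b + (4 * K : ℝ≥0∞) * edist a b := by
          rw [hu_out hbE, edist_comm (0 : ℝ)]
          exact add_le_add h6 h5
      _ = (1 + 4 * K : ℝ≥0∞) * edist a b := by ring
  refine ⟨1 + 4 * K, V, hVnhds, fun a ha b hb ↦ ?_⟩
  have hcoe : ((1 + 4 * K : ℝ≥0) : ℝ≥0∞) = 1 + 4 * K := by push_cast; rfl
  rw [hcoe]
  have hone : (1 : ℝ≥0∞) ≤ 1 + 4 * K := le_self_add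
  have hK' : (K : ℝ≥0∞) ≤ 1 + 4 * K := by
    calc (K : ℝ≥0∞) ≤ 4 * K := le_mul_of_one_le_left zero_le (by norm_num)
      _ ≤ 1 + 4 * K := le_add_self
  by_cases haE : a ∈ E₀ <;> by_cases hbE : b ∈ E₀
  · exact (hEE a haE b hbE).trans (le_mul_of_one_le_left zero_le hone)
  · exact hcross a ha haE b hb hbE
  · rw [edist_comm (u a), edist_comm a]
    exact hcross b hb hbE a ha haE
  · rw [hu_out haE, hu_out hbE]
    refine (hK (hVt a ha haE) (hVt b hb hbE)).trans ?_
    gcongr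

end Extension

/-! ### From a solution on the exterior to a proper solution of (††) -/

section IVP

variable (h : ContMDiffRiemannianMetric (𝓡 3) ∞ E3 (TangentSpace (𝓡 3) : X → Type _))
  [T2Space X] [LocallyCompactSpace X] [MeasurableSpace X] [BorelSpace X]

/-- **From an exterior solution to a proper solution of the initial value problem (††).** Let
`E₀` be open with compact closure and let `u₀` be locally Lipschitz on `E₀ᶜ` (Riemannian distance,
up to the boundary), `u₀ = 0` on `∂E₀`, `u₀ ≥ 0` on `E₀ᶜ`, with compact exterior sublevel sets
`{x ∈ E₀ᶜ | u₀ x ≤ t}` ("`u → ∞ as x → ∞`"), satisfying (1.5) on `M ∖ Ē₀`. Then the negative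
extension `u` of `u₀` (`exists_isLocLipschitzOn_extend_neg`) is proper, solves (††) with initial
condition `E₀` — `u ∈ C^{0,1}_loc`, `E₀ = {u < 0}`, (1.5) on `M ∖ Ē₀` (which only sees `u = u₀`
there, `IsWeakSolution.congr`) — and agrees with `u₀` off `E₀`. This is the conclusion of step 1
of the proof of Thm. 3.1 from its analytic output ("`u ≥ 0` in `M ∖ E₀`, `u → ∞`", "`u` satisfies
(1.5) on `M ∖ Ē₀`", "extend `u` negatively to `E₀` so that `E₀ = {u < 0}`").
[cite: HuiskenIlmanenIMCF2001, proof of Thm. 3.1 step 1] -/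
theorem exists_isWeakSolutionIVP_of_exterior {E₀ : Set X} (hE₀ : IsOpen E₀)
    (hE₀c : IsCompact (closure E₀)) {u₀ : X → ℝ} (hlip : IsLocLipschitzOn h u₀ E₀ᶜ)
    (h0 : ∀ x ∈ frontier E₀, u₀ x = 0) (hpos : ∀ x ∈ E₀ᶜ, 0 ≤ u₀ x)
    (hprop : ∀ t : ℝ, IsCompact {x | x ∈ E₀ᶜ ∧ u₀ x ≤ t})
    (hsol : IsWeakSolution h u₀ (closure E₀)ᶜ) :
    ∃ u : X → ℝ, IsProperFun u ∧ IsWeakSolutionIVP h u E₀ ∧ EqOn u u₀ E₀ᶜ := by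
  obtain ⟨u, hul, hueq, hneg⟩ := exists_isLocLipschitzOn_extend_neg h hE₀ hlip h0
  have huc : Continuous u := hul.continuous h
  refine ⟨u, fun s t ↦ ?_, ⟨hul, ?_, ?_⟩, hueq⟩
  · -- properness: `{s ≤ u ≤ t} ⊆ Ē₀ ∪ {x ∈ E₀ᶜ | u₀ x ≤ t}`
    refine (hE₀c.union (hprop t)).of_isClosed_subset (isClosed_Icc.preimage huc) fun x hx ↦ ?_
    by_cases hxE : x ∈ E₀
    · exact Or.inl (subset_closure hxE)
    · refine Or.inr ⟨hxE, ?_⟩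
      rw [← hueq hxE]
      exact hx.2
  · -- `E₀ = {u < 0}`
    ext x
    refine ⟨fun hx ↦ hneg x hx, fun hx ↦ ?_⟩
    by_contra hxE
    have : 0 ≤ u x := by rw [hueq hxE]; exact hpos x hxE
    exact absurd hx (not_lt.2 this)
  · -- (1.5) on `M ∖ Ē₀` only sees `u = u₀` there
    refine hsol.congr h isClosed_closure.isOpen_compl fun x hx ↦ (hueq ?_).symm
    exact fun hxE ↦ hx (subset_closure hxE)

end IVP

/-! ### Reduction of the Weak Existence Theorem 3.1 to existence on the exterior -/

/-- **`weak_existence` from exterior existence.** The named fact `weak_existence`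
(`InverseMeanCurvatureFlow.lean`; Huisken–Ilmanen 2001, Thm. 3.1 for `n = 3`) follows once, for
every datum of the fact (a complete connected noncompact Riemannian `3`-manifold carrying a proper
weak subsolution of (††) with precompact initial condition, and a nonempty smooth precompact open
`E₀`), there is an *exterior solution*: a function `u₀`, locally Lipschitz on `X ∖ E₀` up to the
boundary, vanishing on `∂E₀`, nonnegative on `X ∖ E₀`, with compact exterior sublevel sets, which
satisfies (1.5) on `X ∖ Ē₀`. This hypothesis is precisely what steps 1–2 of the printed proof
deliver (the locally uniform limit `u` of the regularised solutions `u^ε ≥ 0`, `u^ε = 0` on `∂E₀`,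
with local Lipschitz bounds on compact subsets of `M ∖ E₀`, `u → ∞`, and "(1.5) on `M ∖ Ē₀`" by
the Compactness Theorem 2.1); the conclusion is assembled from it by the negative extension
(`exists_isWeakSolutionIVP_of_exterior`, end of step 1) and the Uniqueness Theorem 2.2 (iii)
(`weak_uniqueness`, last paragraph of the proof).
[cite: HuiskenIlmanenIMCF2001, Thm. 3.1 and its proof (end of step 1; last paragraph of step 2)] -/
theorem weak_existence_of_exterior_existence
    (H : ∀ (X : Type) [TopologicalSpace X] [ChartedSpace E3 X] [IsManifold (𝓡 3) ∞ X]
      [T2Space X] [SecondCountableTopology X] [LocallyCompactSpace X] [ConnectedSpace X]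
      [NoncompactSpace X] [MeasurableSpace X] [BorelSpace X]
      (h : ContMDiffRiemannianMetric (𝓡 3) ∞ E3 (TangentSpace (𝓡 3) : X → Type _))
      [(ofRiemannian h).HasLeviCivita],
      IsGeodesicallyComplete (ofRiemannian h).leviCivita →
      (∃ (v : X → ℝ) (F₀ : Set X), IsProperFun v ∧ IsCompact (closure F₀) ∧
        IsWeakSubsolutionIVP h v F₀) →
      ∀ E₀ : Set X, E₀.Nonempty → IsSmoothPrecompactOpen E₀ →
        ∃ u₀ : X → ℝ, IsLocLipschitzOn h u₀ E₀ᶜ ∧ (∀ x ∈ frontier E₀, u₀ x = 0) ∧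
          (∀ x ∈ E₀ᶜ, 0 ≤ u₀ x) ∧ (∀ t : ℝ, IsCompact {x | x ∈ E₀ᶜ ∧ u₀ x ≤ t}) ∧
          IsWeakSolution h u₀ (closure E₀)ᶜ) :
    weak_existence := by
  intro X _ _ _ _ _ _ _ _ _ _ h _ hcomplete hsub E₀ hne hE₀
  obtain ⟨u₀, hlip, h0, hpos, hprop, hsol⟩ := H X h hcomplete hsub E₀ hne hE₀
  obtain ⟨u, hp, hu, -⟩ :=
    exists_isWeakSolutionIVP_of_exterior h hE₀.1 hE₀.2.1 hlip h0 hpos hprop hsol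
  exact ⟨u, hp, hu, fun u' hp' hu' ↦ weak_uniqueness X h E₀ hE₀.2.1 u hp hu u' hp' hu'⟩

end Literature.Geometry.Lorentzian

end
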